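import Summits.ResolutionOfSingularities.ResolutionOfSingularities.Theorems.FrobeniusLadderFInjectiveMacaulayficationQuarticFrontEnd
import Summits.ResolutionOfSingularities.ResolutionOfSingularities.Theorems.FrobeniusLadderFInjectiveMacaulayficationQuarticBed
import HarnessLib

/-!
# ★★★ T-INSTANCE #3 AS A COMPLETE ROW: the quartic double point `Y = {x² + y⁴ + u⁴ + t⁴ − s⁴}` — SCOPE ∧ FULL vertex ∧ LEGAL-AND-FULL point floor ∧ `TStepInstanceAt p v 𝔪̃`, every `p ≥ 5`
# (crux `FInjectiveMacaulayfication` stmt-ResolutionOfSingularities-15315, chain w45a; the first member of the quartic class row ✓/⧗p687980 `QuarticFrontEnd.tStep_classRow_quarticForm`, with the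
# input FULLness ✓p684332 `QuarticVertexFull`; habitat #3a of `Lines/T-I3-firststep.md`; seat res-L1-w45a-lead-1 g11)

[OURS · L1 W4.5a] Support file (`--supports stmt-ResolutionOfSingularities-15315 --as helper`); def-free; UNCONDITIONAL; no named fact; NOT a statement of any manuscript. An INSTANCE (with its
non-vacuity and a legal FULL input) of the inner block of the T″ stub: evidence for nothing beyond itself; T″ and the F-half OPEN; nothing of the crux proved.
AI-written (AI review is weaker than expert review).

* `isHomogeneous_F`, `f_eq`, `dehomog` (the four dehomogenisations are `1 + Z₀⁴ + Z₁⁴ − Z₂⁴` (thrice) and `Z₀⁴ + Z₁⁴ + Z₂⁴ − 1`);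
* ★★★ `tStep_row_quarticBed` — for every field of characteristic `p ∉ {2,3}`: (SCOPE) ∧ `FullCl p 𝒪_{Y,v}` ∧ (for EVERY blowing up along the point floor: legal ∧ CM ∧ FULL at every stalk —
  a NON-NORMAL floor) ∧ `TStepInstanceAt p v (𝔪̃·𝒪_{Y,v})`.
[folklore assembly; cite: Fedder1983, Thm. 1.12; GortzWedhorn2020, Prop. 13.91 (2); Liu2002, Thm. 8.1.19 (a); StacksProject, Tag 07PF]
-/

-- single-problem summit: the doubled namespace component is forced
set_option linter.dupNamespace false

noncomputable section

namespace Summit.ResolutionOfSingularities.ResolutionOfSingularities.Theorems.FInjectiveMacaulayfication.QuarticRow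

open CategoryTheory CategoryTheory.Limits AlgebraicGeometry TopologicalSpace IsLocalRing MvPolynomial
open Literature.AlgebraicGeometry.Resolution
open Summit.ResolutionOfSingularities.ResolutionOfSingularities.Theorems.FInjectiveMacaulayfication
open SliceableCentre GermOfGlobalBlowup

variable (k : Type) [Field k]

/-- `F = Y₀⁴ + Y₁⁴ + Y₂⁴ − Y₃⁴` is homogeneous of degree `4`. [elementary] -/
theorem isHomogeneous_F : (X 0 ^ 4 + X 1 ^ 4 + X 2 ^ 4 - X 3 ^ 4 : MvPolynomial (Fin 4) k).IsHomogeneous 4 :=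
  (((isHomogeneous_X_pow (R := k) (0 : Fin 4) 4).add (isHomogeneous_X_pow (R := k) (1 : Fin 4) 4)).add
    (isHomogeneous_X_pow (R := k) (2 : Fin 4) 4)).sub (isHomogeneous_X_pow (R := k) (3 : Fin 4) 4)

/-- `f = X₄² + rename castSucc F` is the bed's `X₄² + X₀⁴ + X₁⁴ + X₂⁴ − X₃⁴`. [plumbing] -/
theorem f_eq (f : MvPolynomial (Fin 5) k) (hf : f = X 4 ^ 2 + rename (Fin.castSucc : Fin 4 → Fin 5) (X 0 ^ 4 + X 1 ^ 4 + X 2 ^ 4 - X 3 ^ 4 : MvPolynomial (Fin 4) k)) :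
    f = X 4 ^ 2 + X 0 ^ 4 + X 1 ^ 4 + X 2 ^ 4 - X 3 ^ 4 := by
  rw [hf]
  simp only [map_add, map_sub, map_pow, rename_X]
  have e0 : (Fin.castSucc (0 : Fin 4) : Fin 5) = 0 := rfl
  have e1 : (Fin.castSucc (1 : Fin 4) : Fin 5) = 1 := rfl
  have e2 : (Fin.castSucc (2 : Fin 4) : Fin 5) = 2 := rfl
  have e3 : (Fin.castSucc (3 : Fin 4) : Fin 5) = 3 := rfl
  rw [e0, e1, e2, e3]
  ring

/-- The four dehomogenisations of `F`. [elementary] -/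
theorem dehomog (a : Fin 4) :
    MvPolynomial.aeval ((![![1, X 0, X 1, X 2], ![X 0, 1, X 1, X 2], ![X 0, X 1, 1, X 2], ![X 0, X 1, X 2, 1]] : Fin 4 → Fin 4 → MvPolynomial (Fin 3) k) a)
      (X 0 ^ 4 + X 1 ^ 4 + X 2 ^ 4 - X 3 ^ 4 : MvPolynomial (Fin 4) k) =
      (![1 + X 0 ^ 4 + X 1 ^ 4 - X 2 ^ 4, 1 + X 0 ^ 4 + X 1 ^ 4 - X 2 ^ 4, 1 + X 0 ^ 4 + X 1 ^ 4 - X 2 ^ 4, X 0 ^ 4 + X 1 ^ 4 + X 2 ^ 4 - 1] :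
        Fin 4 → MvPolynomial (Fin 3) k) a := by
  fin_cases a <;> simp <;> ring

/-- ★★★ **T-INSTANCE #3 AS A COMPLETE ROW** — the quartic double point `Y = {x² + y⁴ + u⁴ + t⁴ − s⁴}`, every field of characteristic `p ∉ {2,3}`:
(SCOPE) `v` closed ∧ `v ∉ Reg Y` ∧ `dim 𝒪_{Y,v} = 4`; (INPUT) `𝒪_{Y,v}` FULL; (LEGAL-AND-FULL FLOOR) for EVERY blowing up `S′ → Spec 𝒪_{Y,v}` along `I = 𝔪̃·𝒪_{Y,v}`: (`I ≠ ⊥` ∧ `Supp I ⊆ (Reg)ᶜ` ∧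
`S′` regular off the closed fibre ∧ CM stalks) ∧ `S′` FULL at every stalk (although NON-NORMAL); (INSTANCE) `TStepGerm.TStepInstanceAt p v I` — the reduced singular locus of `S′`, the whole
reduced exceptional divisor (codimension one), is a fibre-supported centre ALL of whose blowings up are REGULAR. [OURS · instance with non-vacuity; evidence for nothing beyond itself] -/
theorem tStep_row_quarticBed (p : ℕ) [Fact p.Prime] [CharP k p] (hp2 : p ≠ 2) (hp3 : p ≠ 3) (f : MvPolynomial (Fin 5) k)
    (hf : f = X 4 ^ 2 + rename (Fin.castSucc : Fin 4 → Fin 5) (X 0 ^ 4 + X 1 ^ 4 + X 2 ^ 4 - X 3 ^ 4 : MvPolynomial (Fin 4) k))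
    (v : Spec (.of (MvPolynomial (Fin 5) k ⧸ Ideal.span {f})))
    (hv : v.asIdeal = Ideal.span (Set.range fun j : Fin 5 => Ideal.Quotient.mk (Ideal.span {f}) (X j))) :
    (IsClosed ({v} : Set (Spec (.of (MvPolynomial (Fin 5) k ⧸ Ideal.span {f})))) ∧
      v ∉ Scheme.regularLocus (Spec (.of (MvPolynomial (Fin 5) k ⧸ Ideal.span {f}))) ∧
      ringKrullDim ((Spec (.of (MvPolynomial (Fin 5) k ⧸ Ideal.span {f}))).presheaf.stalk v) = (4 : ℕ)) ∧
    FullCl p ((Spec (.of (MvPolynomial (Fin 5) k ⧸ Ideal.span {f}))).presheaf.stalk v) ∧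
    (∀ (S' : Scheme.{0}) (g : S' ⟶ Spec ((Spec (.of (MvPolynomial (Fin 5) k ⧸ Ideal.span {f}))).presheaf.stalk v)),
      IsBlowup g ((affineBlowup.idealSheaf (Ideal.span (Set.range (fun j : Fin 5 => Ideal.Quotient.mk (Ideal.span {f}) (X j))))).comap
        ((Spec (.of (MvPolynomial (Fin 5) k ⧸ Ideal.span {f}))).fromSpecStalk v)) →
      (((affineBlowup.idealSheaf (Ideal.span (Set.range (fun j : Fin 5 => Ideal.Quotient.mk (Ideal.span {f}) (X j))))).comap
          ((Spec (.of (MvPolynomial (Fin 5) k ⧸ Ideal.span {f}))).fromSpecStalk v)) ≠ ⊥ ∧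
        (((((affineBlowup.idealSheaf (Ideal.span (Set.range (fun j : Fin 5 => Ideal.Quotient.mk (Ideal.span {f}) (X j))))).comap
            ((Spec (.of (MvPolynomial (Fin 5) k ⧸ Ideal.span {f}))).fromSpecStalk v))).support :
              Set (Spec ((Spec (.of (MvPolynomial (Fin 5) k ⧸ Ideal.span {f}))).presheaf.stalk v))) ⊆
            (Scheme.regularLocus (Spec ((Spec (.of (MvPolynomial (Fin 5) k ⧸ Ideal.span {f}))).presheaf.stalk v)))ᶜ) ∧
        (∀ s : S', g.base s ≠ closedPoint ((Spec (.of (MvPolynomial (Fin 5) k ⧸ Ideal.span {f}))).presheaf.stalk v) → s ∈ Scheme.regularLocus S') ∧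
        (∀ s : S', CMCl (S'.presheaf.stalk s))) ∧
      (∀ s : S', FullCl p (S'.presheaf.stalk s))) ∧
    TStepGerm.TStepInstanceAt p v ((affineBlowup.idealSheaf (Ideal.span (Set.range fun j : Fin 5 => Ideal.Quotient.mk (Ideal.span {f}) (X j)))).comap
      ((Spec (.of (MvPolynomial (Fin 5) k ⧸ Ideal.span {f}))).fromSpecStalk v)) := by
  have h2 : (2 : k) ≠ 0 := (X2Cubic4Specimen.two_three_ne_zero k p hp2 hp3).1
  have hf' := f_eq k f hf
  have hprime := QuarticVertexFull.prime_f4 k h2 f hf'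
  haveI hmax : v.asIdeal.IsMaximal := by rw [hv]; exact DoublePointFermatCubicGerm.isMaximal_origin k f (QuarticBed.constantCoeff_f k f hf')
  obtain ⟨hscope, hfloor, hinst⟩ := QuarticFrontEnd.tStep_classRow_quarticForm k p hp2 _ (isHomogeneous_F k) f hf hprime
    (fun P _ hP => QuarticBed.regular_off_vertex k h2 f hf' P hP)
    (fun a => by
      rw [dehomog]
      fin_cases a <;> first | exact QuarticBed.smooth_W k h2 | exact QuarticBed.smooth_W' k h2) v hv
  exact ⟨hscope, QuarticVertexFull.fullCl_stalk_quarticBed k p hp2 hp3 f hf' v hmax, hfloor, hinst⟩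

end Summit.ResolutionOfSingularities.ResolutionOfSingularities.Theorems.FInjectiveMacaulayfication.QuarticRow

end
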